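import Literature.AlgebraicTopology.SingularHomology.HurewiczOne

/-!
# Helper `helper_friendsCarrier_Vk_partA_partIII_freeLoop` (piece of the registered stub
`helper_friendsCarrier_Vk_partA_partIII`, line `mk_friends`, skeleton v9) for crux `DcrGap`
(item stmt-SmoothPoincare4-16128, route route-SmoothPoincare4-DottedCircleRasmussen)

**Freely homotopic loops have the same Hurewicz class.**  The tree's `loopClass_eq_of_homotopic`
(`…SingularHomology.HurewiczOne`) is for homotopies of loops rel base point; Part III moves the meridian
circle of the slice disc through flat circles of varying radius (the base point moves along a ray), which is
a *free* homotopy of loops `H : [0, 1] × [0, 1] → X`, `H(s, 0) = H(s, 1)`.  Cutting the square along the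
diagonal exactly as in Hatcher's proof of Thm. 2A.1 (the tree's `homotopyUpper` / `homotopyLower`): the
boundary of `H↾upper - H↾lower` is `γ₀ - γ₁ + (β₁ - β₀)` with `β₀ = H(·, 0)`, `β₁ = H(·, 1)` the two
(equal) base point tracks, so `h(γ₀) = h(γ₁)` in `H₁(X; ℤ)`.

* `helper_friendsCarrier_Vk_partA_partIII_freeLoop` — the statement, for loops `γ₀`, `γ₁` agreeing pointwise
  with `H(0, ·)`, `H(1, ·)`.

No definitions, no named facts, no `sorry`.

## References

* A. Hatcher, *Algebraic Topology*, CUP (2002), proof of Thm. 2A.1. [HatcherAT2002]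
-/

-- the prescribed namespace `Summit.<P>.<Sub>.…` duplicates `SmoothPoincare4` (P = Sub)
set_option linter.dupNamespace false
set_option linter.style.longLine false

noncomputable section

open Set Function CategoryTheory
open Literature.AlgebraicTopology.SingularHomology Literature.AlgebraicTopology.SingularHomology.SingularSimplex
  Literature.AlgebraicTopology.SingularHomology.StdSimplex Literature.AlgebraicTopology.SingularHomology.singularChainComplex

namespace Summit.SmoothPoincare4.SmoothPoincare4.Theorems.DcrGap.MkFriends

namespace FriendsCarrierVk

/-- The coface `δ₀` followed by the upper square map: `s ↦ (s₁, 1)`. [folklore] -/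
theorem toSquareUpper_succAbove_zero (s : StdSimplex 1) :
    toSquareUpper ((⟨stdSimplex.map (Fin.succAbove 0), stdSimplex.continuous_map _⟩ :
      C(StdSimplex 1, StdSimplex 2)) s) = (toUnitInterval s, 1) :=
  Prod.ext (Subtype.ext (by
    rw [coe_toSquareUpper_fst, ContinuousMap.coe_mk, map_succAbove_zero_apply_two, coe_toUnitInterval]))
    (Subtype.ext (by
    rw [coe_toSquareUpper_snd, ContinuousMap.coe_mk, map_succAbove_zero_apply_one, map_succAbove_zero_apply_two,
      one_dim_add, Set.Icc.coe_one]))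

/-- The coface `δ₁` followed by the upper square map: the diagonal `s ↦ (s₁, s₁)`. [folklore] -/
theorem toSquareUpper_succAbove_one (s : StdSimplex 1) :
    toSquareUpper ((⟨stdSimplex.map (Fin.succAbove 1), stdSimplex.continuous_map _⟩ :
      C(StdSimplex 1, StdSimplex 2)) s) = (toUnitInterval s, toUnitInterval s) :=
  Prod.ext (Subtype.ext (by
    rw [coe_toSquareUpper_fst, ContinuousMap.coe_mk, map_succAbove_one_apply_two, coe_toUnitInterval]))
    (Subtype.ext (by
    rw [coe_toSquareUpper_snd, ContinuousMap.coe_mk, map_succAbove_one_apply_one, map_succAbove_one_apply_two,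
      coe_toUnitInterval, zero_add]))

/-- The coface `δ₂` followed by the upper square map: `s ↦ (0, s₁)`. [folklore] -/
theorem toSquareUpper_succAbove_two (s : StdSimplex 1) :
    toSquareUpper ((⟨stdSimplex.map (Fin.succAbove 2), stdSimplex.continuous_map _⟩ :
      C(StdSimplex 1, StdSimplex 2)) s) = (0, toUnitInterval s) :=
  Prod.ext (Subtype.ext (by
    rw [coe_toSquareUpper_fst, ContinuousMap.coe_mk, map_succAbove_two_apply_two, Set.Icc.coe_zero]))
    (Subtype.ext (by
    rw [coe_toSquareUpper_snd, ContinuousMap.coe_mk, map_succAbove_two_apply_one, map_succAbove_two_apply_two,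
      coe_toUnitInterval, add_zero]))

/-- The coface `δ₀` followed by the lower square map: `s ↦ (1, s₁)`. [folklore] -/
theorem toSquareLower_succAbove_zero (s : StdSimplex 1) :
    toSquareLower ((⟨stdSimplex.map (Fin.succAbove 0), stdSimplex.continuous_map _⟩ :
      C(StdSimplex 1, StdSimplex 2)) s) = (1, toUnitInterval s) :=
  Prod.ext (Subtype.ext (by
    rw [coe_toSquareLower_fst, ContinuousMap.coe_mk, map_succAbove_zero_apply_one, map_succAbove_zero_apply_two,
      one_dim_add, Set.Icc.coe_one]))
    (Subtype.ext (by
    rw [coe_toSquareLower_snd, ContinuousMap.coe_mk, map_succAbove_zero_apply_two, coe_toUnitInterval]))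

/-- The coface `δ₁` followed by the lower square map: the diagonal. [folklore] -/
theorem toSquareLower_succAbove_one (s : StdSimplex 1) :
    toSquareLower ((⟨stdSimplex.map (Fin.succAbove 1), stdSimplex.continuous_map _⟩ :
      C(StdSimplex 1, StdSimplex 2)) s) = (toUnitInterval s, toUnitInterval s) :=
  Prod.ext (Subtype.ext (by
    rw [coe_toSquareLower_fst, ContinuousMap.coe_mk, map_succAbove_one_apply_one, map_succAbove_one_apply_two,
      coe_toUnitInterval, zero_add]))
    (Subtype.ext (by
    rw [coe_toSquareLower_snd, ContinuousMap.coe_mk, map_succAbove_one_apply_two, coe_toUnitInterval]))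

/-- The coface `δ₂` followed by the lower square map: `s ↦ (s₁, 0)`. [folklore] -/
theorem toSquareLower_succAbove_two (s : StdSimplex 1) :
    toSquareLower ((⟨stdSimplex.map (Fin.succAbove 2), stdSimplex.continuous_map _⟩ :
      C(StdSimplex 1, StdSimplex 2)) s) = (toUnitInterval s, 0) :=
  Prod.ext (Subtype.ext (by
    rw [coe_toSquareLower_fst, ContinuousMap.coe_mk, map_succAbove_two_apply_one, map_succAbove_two_apply_two,
      coe_toUnitInterval, add_zero]))
    (Subtype.ext (by
    rw [coe_toSquareLower_snd, ContinuousMap.coe_mk, map_succAbove_two_apply_two, Set.Icc.coe_zero]))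

/-- **Freely homotopic loops have the same Hurewicz class** (Hatcher 2002, proof of Thm. 2A.1, with a
moving base point): for `H : [0,1]² → X` with `H(s, 0) = H(s, 1)` and loops `γ₀ = H(0, ·)`, `γ₁ = H(1, ·)`
(pointwise), `h(γ₀) = h(γ₁)` in `H₁(X; ℤ)`. [cite: HatcherAT2002, Thm. 2A.1] -/
theorem loopClass_eq_of_loopHomotopy {X : Type} [TopologicalSpace X] (H : C(unitInterval × unitInterval, X))
    (hH : ∀ s, H (s, 0) = H (s, 1)) {a b : X} (γ₀ : Path a a) (γ₁ : Path b b)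
    (h₀ : ∀ t, γ₀ t = H (0, t)) (h₁ : ∀ t, γ₁ t = H (1, t)) :
    loopClass ℤ ℤ (1 : ℤ) γ₀ = loopClass ℤ ℤ (1 : ℤ) γ₁ := by
  -- the two triangles of the square and the three auxiliary paths
  let up : SingularSimplex X 2 := toContinuousMap.symm (H.comp toSquareUpper)
  let lo : SingularSimplex X 2 := toContinuousMap.symm (H.comp toSquareLower)
  have hup : ∀ t, toContinuousMap up t = H (toSquareUpper t) := fun t => by
    simp only [up, Equiv.apply_symm_apply]; rfl
  have hlo : ∀ t, toContinuousMap lo t = H (toSquareLower t) := fun t => by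
    simp only [lo, Equiv.apply_symm_apply]; rfl
  let β₀ : Path (H (0, 0)) (H (1, 0)) := ⟨⟨fun s => H (s, 0), by fun_prop⟩, rfl, rfl⟩
  let β₁ : Path (H (0, 1)) (H (1, 1)) := ⟨⟨fun s => H (s, 1), by fun_prop⟩, rfl, rfl⟩
  let dg : Path (H (0, 0)) (H (1, 1)) := ⟨⟨fun s => H (s, s), by fun_prop⟩, rfl, rfl⟩
  let e₀ : Path (H (0, 0)) (H (0, 1)) := ⟨⟨fun t => H (0, t), by fun_prop⟩, rfl, rfl⟩
  let e₁ : Path (H (1, 0)) (H (1, 1)) := ⟨⟨fun t => H (1, t), by fun_prop⟩, rfl, rfl⟩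
  have hβ : ofPath β₀ = ofPath β₁ := by
    apply toContinuousMap_injective; ext s : 1
    rw [ofPath_apply, ofPath_apply]
    exact hH _
  have he₀ : ofPath γ₀ = ofPath e₀ := by
    apply toContinuousMap_injective; ext s : 1
    rw [ofPath_apply, ofPath_apply]
    exact h₀ _
  have he₁ : ofPath γ₁ = ofPath e₁ := by
    apply toContinuousMap_injective; ext s : 1
    rw [ofPath_apply, ofPath_apply]
    exact h₁ _
  -- faces
  have hu0 : up.face 0 = ofPath β₁ := by
    apply toContinuousMap_injective; ext s : 1
    rw [toContinuousMap_face, ContinuousMap.comp_apply, hup, ofPath_apply, toSquareUpper_succAbove_zero]; rfl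
  have hu1 : up.face 1 = ofPath dg := by
    apply toContinuousMap_injective; ext s : 1
    rw [toContinuousMap_face, ContinuousMap.comp_apply, hup, ofPath_apply, toSquareUpper_succAbove_one]; rfl
  have hu2 : up.face 2 = ofPath e₀ := by
    apply toContinuousMap_injective; ext s : 1
    rw [toContinuousMap_face, ContinuousMap.comp_apply, hup, ofPath_apply, toSquareUpper_succAbove_two]; rfl
  have hl0 : lo.face 0 = ofPath e₁ := by
    apply toContinuousMap_injective; ext s : 1
    rw [toContinuousMap_face, ContinuousMap.comp_apply, hlo, ofPath_apply, toSquareLower_succAbove_zero]; rfl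
  have hl1 : lo.face 1 = ofPath dg := by
    apply toContinuousMap_injective; ext s : 1
    rw [toContinuousMap_face, ContinuousMap.comp_apply, hlo, ofPath_apply, toSquareLower_succAbove_one]; rfl
  have hl2 : lo.face 2 = ofPath β₀ := by
    apply toContinuousMap_injective; ext s : 1
    rw [toContinuousMap_face, ContinuousMap.comp_apply, hlo, ofPath_apply, toSquareLower_succAbove_two]; rfl
  -- the boundary of `up - lo` is `γ₀ - γ₁`
  rw [loopClass, loopClass, homologyCls_eq_homologyCls_iff, exists_d_prev_eq_iff (i := 2) (ChainComplex.prev ℕ 1)]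
  refine ⟨single (R := ℤ) up (1 : ℤ) - single (R := ℤ) lo (1 : ℤ), ?_⟩
  rw [map_sub, d_single_two, d_single_two, hu0, hu1, hu2, hl0, hl1, hl2, hβ, he₀, he₁]
  abel

end FriendsCarrierVk

open FriendsCarrierVk in
/-- **Helper `helper_friendsCarrier_Vk_partA_partIII_freeLoop`** (piece of `helper_friendsCarrier_Vk_partA_partIII`:
freely homotopic loops — a homotopy of loops whose base point may move — have the same Hurewicz class in
`H₁(X; ℤ)`; see the module docstring). [cite: HatcherAT2002, Thm. 2A.1] -/
theorem helper_friendsCarrier_Vk_partA_partIII_freeLoop : ∀ (X : Type) [TopologicalSpace X] (H : unitInterval × unitInterval → X), Continuous H → (∀ s : unitInterval, H (s, 0) = H (s, 1)) → ∀ (a b : X) (γ₀ : Path a a) (γ₁ : Path b b), (∀ t, γ₀ t = H (0, t)) → (∀ t, γ₁ t = H (1, t)) → Literature.AlgebraicTopology.SingularHomology.loopClass ℤ ℤ (1 : ℤ) γ₀ = Literature.AlgebraicTopology.SingularHomology.loopClass ℤ ℤ (1 : ℤ) γ₁ :=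
  fun _ _ H hH hHs _ _ γ₀ γ₁ h₀ h₁ => loopClass_eq_of_loopHomotopy ⟨H, hH⟩ hHs γ₀ γ₁ h₀ h₁

end Summit.SmoothPoincare4.SmoothPoincare4.Theorems.DcrGap.MkFriends

end
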